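import Summits.Langlands.Langlands.Theorems.AbelianSurfaceSerreSerreGSp4SurjectiveStubIrredOfResidual
import Summits.Langlands.Langlands.Theorems.RamifiedCoefficientSeedAdjointLiftingGL3StubEnormousAdPrelim
import Literature.NumberTheory.GaloisRepresentations.ResidualGaloisRepOpenKernel
import Literature.NumberTheory.GaloisRepresentations.StableLatticeValuationRing
import Literature.NumberTheory.Automorphic.LanglandsTetrahedral
import HarnessLib

/-!
# Crux `SerreGSp4Surjective` (stmt-Langlands-17765), line `singer-type-evaporation`:
# stub `stub_residualExists` — a finite-field residual representation exists along some residue map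

Registered signature (skeleton v9), proved VERBATIM below: every continuous
`r : Γ_ℚ → GL₄(ℚ̄_ℓ)` (`FramedGaloisRep ℚ (PadicAlgCl ℓ) 4`) reduces, ALONG some ring map
`red : 𝒪_{ℚ̄_ℓ} → k̄` (`ReducesAlong`, the landed stub-4 module
`AbelianSurfaceSerreSerreGSp4SurjectiveStubAutomorphyLifting`), to some continuous
`ρ' : Γ_ℚ → GL₄(k)` with `k` a FINITE field of characteristic `ℓ` carrying the discrete topology.

Proof (Darmon–Diamond–Taylor 1995, §2.1, folklore):
1. `Γ_ℚ` is compact and the valuation ring `𝒪 = ℤ̄_ℓ` of `ℚ̄_ℓ` is open, so `r` has an integral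
   model `ρ₀ : Γ_ℚ → GL₄(𝒪)`, `ρ₀ = P⁻¹ r P` (tree: `exists_integralModel_of_valuationSubring`, the
   non-Noetherian stable-lattice theorem of `StableLatticeValuationRing`);
2. its reduction `τ = ρ₀ mod 𝔪 : Γ_ℚ → GL₄(𝒪/𝔪)` has open kernel (`isOpen_ker_residualRep`,
   `𝔪 ⊂ ℚ̄_ℓ` is the open unit ball), hence finite image (`Γ_ℚ` compact);
3. the finitely many matrix entries of the image generate a finite subfield `k ⊂ 𝒪/𝔪`: the
   residue field `𝒪/𝔪` is algebraic over `𝔽_ℓ` (tree: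
   `isAlgebraic_zmod_padicAlgClResidueField`, via `ℤ̄_ℓ` integral over `ℤ_ℓ`), so a finitely
   generated subextension is finite (Mathlib `IntermediateField.finiteDimensional_adjoin`);
4. `τ` factors through `GL₄(k) ↪ GL₄(𝒪/𝔪)` (`exists_monoidHom_map_eq_of_injective`), giving
   `ρ' : Γ_ℚ → GL₄(k)`, continuous for the discrete topology on `k` because its kernel `= ker τ` is
   open (tree: `MonoidHom.continuous_of_isOpen_ker` of `Automorphic/LanglandsTetrahedral`);
5. `red : 𝒪 → 𝒪/𝔪 → k̄` with the second arrow a `k`-embedding (`IsAlgClosed.lift`; `𝒪/𝔪` is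
   algebraic over `k`);
6. for every `g`, `P_g = det(X - ρ₀(g)) ∈ 𝒪[X]` maps to `det(X - r(g))` in `ℚ̄_ℓ[X]`
   (`charpoly_integralModel`) and, along `red`, to the image in `k̄[X]` of `det(X - ρ'(g)) ∈ k[X]`
   (`charpoly_residualRep`, `Matrix.charpoly_map`, and `red|_k = algebraMap k k̄` because the
   embedding is `k`-linear) — which is `ReducesAlong ℓ red r ρ'`.

No named fact is used; no definition is introduced.

References: H. Darmon, F. Diamond, R. Taylor, *Fermat's Last Theorem* (1995), §2.1, p. 54;
P. Deligne, J.-P. Serre, *Formes modulaires de poids 1* (1974), 6.12.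
-/

set_option linter.dupNamespace false -- `Summit.Langlands.Langlands` is the mandated namespace

namespace Summit.Langlands.Langlands.Cruxes.SerreGSp4Surjective.SingerTypeEvaporation

open Literature.NumberTheory.GaloisRepresentations Literature.NumberTheory.Automorphic
open scoped NumberField
open IsDedekindDomain Polynomial Filter
open Summit.Langlands.Langlands.Cruxes.AdjointLiftingGL3.Birth (isAlgebraic_zmod_padicAlgClResidueField)

noncomputable section

/-! ## Matrix groups over a subring along an injective ring map -/

section GLRange

variable {R S : Type*} [CommRing R] [CommRing S] {m : Type*} [Fintype m] [DecidableEq m]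

/-- `GL_m(f)` is injective when `f : R →+* S` is. [folklore] -/
theorem generalLinearGroup_map_injective {f : R →+* S} (hf : Function.Injective f) :
    Function.Injective (Matrix.GeneralLinearGroup.map (n := m) f) := by
  intro A B h
  refine Units.ext (Matrix.ext fun i j => hf ?_)
  have := congrArg (fun M : GL m S => (M : Matrix m m S) i j) h
  simpa [Matrix.GeneralLinearGroup.map] using this

/-- An invertible matrix over `S` whose entries, and whose inverse's entries, come from `R` along
an injective `f : R →+* S` lies in the image of `GL_m(R)`. [folklore] -/
theorem mem_range_generalLinearGroup_map {f : R →+* S} (hf : Function.Injective f) (M : GL m S)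
    (hM : ∀ i j, (M : Matrix m m S) i j ∈ f.range)
    (hM' : ∀ i j, ((M⁻¹ : GL m S) : Matrix m m S) i j ∈ f.range) :
    M ∈ (Matrix.GeneralLinearGroup.map f).range := by
  choose A hA using hM
  choose B hB using hM'
  have hA' : (Matrix.of A).map f = (M : Matrix m m S) := Matrix.ext fun i j => hA i j
  have hB' : (Matrix.of B).map f = ((M⁻¹ : GL m S) : Matrix m m S) :=
    Matrix.ext fun i j => hB i j
  have hinj : Function.Injective fun N : Matrix m m R => N.map f := fun N N' h =>
    Matrix.ext fun i j => hf (congr_fun (congr_fun h i) j)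
  have h1 : (1 : Matrix m m R).map f = 1 := Matrix.map_one f (map_zero f) (map_one f)
  have hAB : Matrix.of A * Matrix.of B = 1 := hinj (by
    dsimp only
    rw [Matrix.map_mul, hA', hB', h1, ← Units.val_mul, mul_inv_cancel, Units.val_one])
  have hBA : Matrix.of B * Matrix.of A = 1 := hinj (by
    dsimp only
    rw [Matrix.map_mul, hA', hB', h1, ← Units.val_mul, inv_mul_cancel, Units.val_one])
  exact ⟨⟨Matrix.of A, Matrix.of B, hAB, hBA⟩, Units.ext hA'⟩

/-- A homomorphism `G → GL_m(S)` with values in the image of `GL_m(R)` along an injective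
`f : R →+* S` lifts to a homomorphism `G → GL_m(R)` (the tree's `exists_monoidHom_map_eq`, stated
there for the inclusion of a valuation subring, verbatim for an injective ring map). [folklore] -/
theorem exists_monoidHom_map_eq_of_injective {G : Type*} [Group G] {f : R →+* S}
    (hf : Function.Injective f) (φ : G →* GL m S)
    (hφ : ∀ g, φ g ∈ (Matrix.GeneralLinearGroup.map f).range) :
    ∃ φ₀ : G →* GL m R, ∀ g, Matrix.GeneralLinearGroup.map f (φ₀ g) = φ g := by
  -- adapted from `Literature.NumberTheory.GaloisRepresentations.exists_monoidHom_map_eq`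
  let e : GL m R ≃* (Matrix.GeneralLinearGroup.map (n := m) f).range :=
    MonoidHom.ofInjective (generalLinearGroup_map_injective hf)
  let φ' : G →* (Matrix.GeneralLinearGroup.map (n := m) f).range := φ.codRestrict _ hφ
  refine ⟨e.symm.toMonoidHom.comp φ', fun g => ?_⟩
  have h1 : (Matrix.GeneralLinearGroup.map f (e.symm (φ' g)) : GL m S) =
      ((e (e.symm (φ' g)) : (Matrix.GeneralLinearGroup.map (n := m) f).range) : GL m S) := rfl
  rw [MonoidHom.comp_apply, MulEquiv.coe_toMonoidHom, h1, MulEquiv.apply_symm_apply]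
  rfl

end GLRange

/-! ## The stub -/

/-- **Stub `stub_residualExists` (registered signature, verbatim; skeleton v9).**  Every continuous
`r : Γ_ℚ → GL₄(ℚ̄_ℓ)` reduces, along some `red : 𝒪_{ℚ̄_ℓ} → k̄`, to some continuous
`ρ' : Γ_ℚ → GL₄(k)` with `k` a finite field of characteristic `ℓ` (discrete topology): integral
model over the open valuation ring `𝒪_{ℚ̄_ℓ}` (`exists_integralModel_of_valuationSubring`),
reduction modulo `𝔪` (open kernel, `isOpen_ker_residualRep`, hence finite image), `k` the subfield
of `𝒪/𝔪` generated over `𝔽_ℓ` by the finitely many matrix entries of the image (finite because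
`𝒪/𝔪` is algebraic over `𝔽_ℓ`, `isAlgebraic_zmod_padicAlgClResidueField`), `ρ'` the
factorisation of the reduction through `GL₄(k)`, `red = ι ∘ (mod 𝔪)` for a `k`-embedding
`ι : 𝒪/𝔪 → k̄` (`IsAlgClosed.lift`); the characteristic polynomials reduce coefficientwise
(`charpoly_integralModel`, `charpoly_residualRep`). [cite: DarmonDiamondTaylor1995, §2.1] -/
theorem stub_residualExists :
    ∀ (ℓ : ℕ) [Fact ℓ.Prime] (r : FramedGaloisRep ℚ (PadicAlgCl ℓ) 4),
      ∃ (k : Type) (_ : Field k) (_ : Fintype k) (_ : CharP k ℓ) (_ : TopologicalSpace k)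
        (_ : DiscreteTopology k) (ρ' : FramedGaloisRep ℚ k 4)
        (red : (Valued.v : Valuation (PadicAlgCl ℓ) NNReal).valuationSubring →+*
          AlgebraicClosure k),
        ReducesAlong ℓ red r ρ' := by
  intro ℓ _ r
  classical
  -- (1) an integral model `ρ₀ = P⁻¹ r P : Γ_ℚ → GL₄(𝒪)` over `𝒪 = ℤ̄_ℓ`
  obtain ⟨P, ρ₀, hP⟩ := exists_integralModel_of_valuationSubring (O := padicAlgClIntegers ℓ)
    (Valued.isOpen_valuationSubring (PadicAlgCl ℓ)) r
  -- (2) its reduction `τ = ρ₀ mod 𝔪 : Γ_ℚ → GL₄(𝒪/𝔪)` has open kernel, hence finite image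
  set τ : Field.absoluteGaloisGroup ℚ →* GL (Fin 4) (padicAlgClResidueField ℓ) :=
    (Matrix.GeneralLinearGroup.map (IsLocalRing.residue (padicAlgClIntegers ℓ))).comp ρ₀
    with hτdef
  have hker : IsOpen (τ.ker : Set (Field.absoluteGaloisGroup ℚ)) :=
    isOpen_ker_residualRep isOpen_setOf_mem_maximalIdeal_padicAlgClIntegers hP
  haveI : Finite (Field.absoluteGaloisGroup ℚ ⧸ τ.ker) := Subgroup.quotient_finite_of_isOpen _ hker
  have hfin : (Set.range τ).Finite := by
    haveI : Finite τ.range :=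
      Finite.of_equiv _ (QuotientGroup.quotientKerEquivRange τ).toEquiv
    rw [← MonoidHom.coe_range]
    exact Set.toFinite _
  -- the finite set `S` of matrix entries of the image of `τ`
  set S : Set (padicAlgClResidueField ℓ) :=
    (fun q : GL (Fin 4) (padicAlgClResidueField ℓ) × Fin 4 × Fin 4 =>
      (q.1 : Matrix (Fin 4) (Fin 4) (padicAlgClResidueField ℓ)) q.2.1 q.2.2) ''
        (Set.range τ ×ˢ Set.univ) with hSdef
  have hSfin : S.Finite := (hfin.prod Set.finite_univ).image _
  have hmemS : ∀ (g : Field.absoluteGaloisGroup ℚ) (i j : Fin 4),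
      ((τ g : GL (Fin 4) (padicAlgClResidueField ℓ)) :
        Matrix (Fin 4) (Fin 4) (padicAlgClResidueField ℓ)) i j ∈ S :=
    fun g i j => ⟨(τ g, i, j), Set.mk_mem_prod ⟨g, rfl⟩ (Set.mem_univ _), rfl⟩
  have hmemS' : ∀ (g : Field.absoluteGaloisGroup ℚ) (i j : Fin 4),
      (((τ g)⁻¹ : GL (Fin 4) (padicAlgClResidueField ℓ)) :
        Matrix (Fin 4) (Fin 4) (padicAlgClResidueField ℓ)) i j ∈ S := fun g i j => by
    rw [← map_inv]
    exact hmemS g⁻¹ i j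
  -- (3) the finite subfield `k ⊂ 𝒪/𝔪` generated by `S` (`𝒪/𝔪` is algebraic over `𝔽_ℓ`)
  letI := charP_padicAlgClResidueField ℓ
  letI := ZMod.algebra (padicAlgClResidueField ℓ) ℓ
  haveI := isAlgebraic_zmod_padicAlgClResidueField ℓ
  set K₀ : IntermediateField (ZMod ℓ) (padicAlgClResidueField ℓ) :=
    IntermediateField.adjoin (ZMod ℓ) S with hK₀def
  haveI : Finite S := hSfin.to_subtype
  haveI : FiniteDimensional (ZMod ℓ) K₀ :=
    IntermediateField.finiteDimensional_adjoin fun x _ =>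
      (Algebra.IsAlgebraic.isAlgebraic x).isIntegral
  haveI : Finite K₀ := Module.finite_of_finite (ZMod ℓ)
  have hSK : S ⊆ K₀ := IntermediateField.subset_adjoin (ZMod ℓ) S
  have hinjK : Function.Injective (algebraMap K₀ (padicAlgClResidueField ℓ)) :=
    (algebraMap K₀ (padicAlgClResidueField ℓ)).injective
  -- (4) `τ` takes values in `GL₄(k)`: `τ = GL₄(k ↪ 𝒪/𝔪) ∘ ρ₁`
  obtain ⟨ρ₁, hρ₁⟩ := exists_monoidHom_map_eq_of_injective hinjK τ fun g =>
    mem_range_generalLinearGroup_map hinjK (τ g)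
      (fun i j => ⟨⟨_, hSK (hmemS g i j)⟩, rfl⟩)
      (fun i j => ⟨⟨_, hSK (hmemS' g i j)⟩, rfl⟩)
  -- (5) `ρ₁` is continuous for the discrete topology on `k`: `ker ρ₁ = ker τ` is open
  letI : TopologicalSpace K₀ := ⊥
  haveI : DiscreteTopology K₀ := ⟨rfl⟩
  have hker₁ : IsOpen (ρ₁.ker : Set (Field.absoluteGaloisGroup ℚ)) := by
    refine Subgroup.isOpen_mono (fun g hg => ?_) hker
    rw [MonoidHom.mem_ker] at hg ⊢
    apply generalLinearGroup_map_injective hinjK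
    rw [hρ₁ g, hg, map_one]
  let ρ' : FramedGaloisRep ℚ K₀ 4 := ⟨ρ₁, MonoidHom.continuous_of_isOpen_ker ρ₁ hker₁⟩
  -- (6) the residue map `red : 𝒪 → 𝒪/𝔪 → k̄`, the second arrow a `k`-embedding
  -- (the two torsion-freeness instances `IsAlgClosed.lift` asks for, supplied by hand to spare
  -- the instance search)
  have hnz : NoZeroSMulDivisors K₀ (AlgebraicClosure K₀) := GroupWithZero.toNoZeroSMulDivisors
  haveI : Module.IsTorsionFree K₀ (AlgebraicClosure K₀) :=
    .of_smul_eq_zero fun _ _ h => hnz.eq_zero_or_eq_zero_of_smul_eq_zero h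
  have hnz' : NoZeroSMulDivisors K₀ (padicAlgClResidueField ℓ) :=
    GroupWithZero.toNoZeroSMulDivisors
  haveI : Module.IsTorsionFree K₀ (padicAlgClResidueField ℓ) :=
    .of_smul_eq_zero fun _ _ h => hnz'.eq_zero_or_eq_zero_of_smul_eq_zero h
  let emb : padicAlgClResidueField ℓ →ₐ[K₀] AlgebraicClosure K₀ := IsAlgClosed.lift
  let red : padicAlgClIntegers ℓ →+* AlgebraicClosure K₀ :=
    (emb : padicAlgClResidueField ℓ →+* AlgebraicClosure K₀).comp
      (IsLocalRing.residue (padicAlgClIntegers ℓ))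
  refine ⟨K₀, inferInstance, Fintype.ofFinite _,
    charP_of_injective_algebraMap (algebraMap (ZMod ℓ) K₀).injective ℓ, ⊥, ⟨rfl⟩, ρ', red,
    fun g => ?_⟩
  -- (7) the characteristic polynomials reduce coefficientwise along `red`
  refine ⟨((ρ₀ g : GL (Fin 4) (padicAlgClIntegers ℓ)) :
      Matrix (Fin 4) (Fin 4) (padicAlgClIntegers ℓ)).charpoly, charpoly_integralModel hP g, ?_⟩
  have hτg : ((τ g : GL (Fin 4) (padicAlgClResidueField ℓ)) :
      Matrix (Fin 4) (Fin 4) (padicAlgClResidueField ℓ)) =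
      ((ρ₁ g : GL (Fin 4) K₀) : Matrix (Fin 4) (Fin 4) K₀).map
        (algebraMap K₀ (padicAlgClResidueField ℓ)) := by
    rw [← hρ₁ g]
    rfl
  rw [FramedRep.charpoly, ← Polynomial.map_map, ← charpoly_residualRep ρ₀ g, ← hτdef, hτg,
    Matrix.charpoly_map, Polynomial.map_map, AlgHom.comp_algebraMap]
  rfl

end

end Summit.Langlands.Langlands.Cruxes.SerreGSp4Surjective.SingerTypeEvaporation
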